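import Mathlib

/-!
# `GrenetZeon.DualUnipotentThreeHalves` (stmt-ValiantsHypothesis-24318), R2 heavy-top instrument — P-Q1 Level 2, L2.0:
# UNIQUE LIFTS over the initial subspace (the chart of Q1-PROOF §2, for any diagonal torus)

Experiment cell «val-heavytop-census» (D-0160), engine seat val-htc-eng-2 g3 (kernel-only lane; P-Q1 port, eng lineage; lead-g2/g3 Level-2 port map L2.0).
Setting of ✓ `HeavyTopTorusInitial.exists_torus_initial_subspace`: row weights `ρ : Fin n → ℕ`, degree of the position `(a,b)` = `ρ a − ρ b`,
degree projections `π_d`.  Let `V ≤ T`, let `W ≤ T` be «the initial subspace» of `V` (here abstractly: `finrank W = finrank V`, `W` graded, and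
`π_d Z ∈ W` for every `Z ∈ V` without entries of degree `< d` — gradedness of `W` itself is not even needed), and let `C ≤ T` be a GRADED COMPLEMENT of `W` in `T` (`C` graded, `W ⊓ C = ⊥`,
`T ≤ W ⊔ C`).  THEN (★ `lift_exists_unique`): `V ⊓ C = ⊥`, `T ≤ V ⊔ C`, and every homogeneous `b ∈ W` of degree `d` has a UNIQUE lift `v ∈ V` with
`v − b ∈ C`, whose tail `v − b` has no component of degree `≤ d` (Q1-PROOF §2 «CHART»: `b̂ − b ∈ span 𝒞_{>deg b}`).  Proofs: lowest components —
a lowest non-zero component of an element of `V` is an initial form, hence in `W`; of an element of `C` it is in `C`; `W ⊓ C = ⊥`.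

* `proj_add`, `proj_smul`, `proj_proj`, `eq_zero_of_proj_eq_zero`, `exists_lowest_degree` — bookkeeping for the projections `π_d`;
* ★ `lift_exists_unique`.

Honest framing: a step of the instrument's kernel port P-Q1 (Level 2); nothing here proves or refutes `HeavyTopLaw`/`HeavyTopSlowLaw`, 24318, S3 or 8062;
`VP ≠ VNP` is NOT proved.  No definitions.  [Q1-PROOF §2 CHART (val-htc-lead g2); lead Level-2 port map L2.0; this seat]
-/

noncomputable section

-- single-conjunct layout: Sub = Summit, duplicated namespace component intended
set_option linter.dupNamespace false

namespace Summit.ValiantsHypothesis.ValiantsHypothesis.Theorems.GrenetZeon.HeavyTopInitialLift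

open Matrix

variable {n : ℕ}

/-- `π_d` is additive. -/
theorem proj_add (ρ : Fin n → ℕ) (d : ℤ) (X Y : Matrix (Fin n) (Fin n) ℂ) :
    (Matrix.of fun a b : Fin n => if (ρ a : ℤ) - ρ b = d then (X + Y) a b else 0) =
      (Matrix.of fun a b : Fin n => if (ρ a : ℤ) - ρ b = d then X a b else 0) +
        (Matrix.of fun a b : Fin n => if (ρ a : ℤ) - ρ b = d then Y a b else 0) := by
  ext a b; simp only [Matrix.of_apply, Matrix.add_apply]; split_ifs <;> simp

/-- `π_d` commutes with scalars. -/
theorem proj_smul (ρ : Fin n → ℕ) (d : ℤ) (c : ℂ) (X : Matrix (Fin n) (Fin n) ℂ) :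
    (Matrix.of fun a b : Fin n => if (ρ a : ℤ) - ρ b = d then (c • X) a b else 0) =
      c • (Matrix.of fun a b : Fin n => if (ρ a : ℤ) - ρ b = d then X a b else 0) := by
  ext a b; simp only [Matrix.of_apply, Matrix.smul_apply, smul_eq_mul]; split_ifs <;> simp

/-- `π_e ∘ π_d = [e = d] π_d`. -/
theorem proj_proj (ρ : Fin n → ℕ) (e d : ℤ) (X : Matrix (Fin n) (Fin n) ℂ) :
    (Matrix.of fun a b : Fin n => if (ρ a : ℤ) - ρ b = e then
        (Matrix.of fun a' b' : Fin n => if (ρ a' : ℤ) - ρ b' = d then X a' b' else 0) a b else 0) =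
      if e = d then (Matrix.of fun a b : Fin n => if (ρ a : ℤ) - ρ b = d then X a b else 0) else 0 := by
  ext a b
  simp only [Matrix.of_apply]
  by_cases hed : e = d
  · subst hed; simp only [if_true, Matrix.of_apply]; split_ifs <;> rfl
  · rw [if_neg hed, Matrix.zero_apply]
    split_ifs with h1 h2
    · exact absurd (h1.symm.trans h2) hed
    · rfl
    · rfl

/-- A matrix all of whose degree components vanish is zero. -/
theorem eq_zero_of_proj_eq_zero (ρ : Fin n → ℕ) (X : Matrix (Fin n) (Fin n) ℂ)
    (h : ∀ d : ℤ, (Matrix.of fun a b : Fin n => if (ρ a : ℤ) - ρ b = d then X a b else 0) = 0) : X = 0 := by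
  ext a b
  have e := congr_fun (congr_fun (h ((ρ a : ℤ) - ρ b)) a) b
  simpa using e

/-- A non-zero matrix has a LOWEST degree: some `d₀` with `π_{d₀} X ≠ 0` and all entries of degree `< d₀` zero. -/
theorem exists_lowest_degree (ρ : Fin n → ℕ) (X : Matrix (Fin n) (Fin n) ℂ) (hX : X ≠ 0) :
    ∃ d₀ : ℤ, (Matrix.of fun a b : Fin n => if (ρ a : ℤ) - ρ b = d₀ then X a b else 0) ≠ 0 ∧
      ∀ a b : Fin n, (ρ a : ℤ) - ρ b < d₀ → X a b = 0 := by
  classical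
  -- the finite set of degrees carrying a non-zero entry
  set D : Finset ℤ := (Finset.univ.filter (fun p : Fin n × Fin n => X p.1 p.2 ≠ 0)).image
    (fun p : Fin n × Fin n => (ρ p.1 : ℤ) - ρ p.2) with hD
  have hDne : D.Nonempty := by
    obtain ⟨a, b, hab⟩ : ∃ a b, X a b ≠ 0 := by
      by_contra hno
      push Not at hno
      exact hX (Matrix.ext fun a b => hno a b)
    exact ⟨_, Finset.mem_image.2 ⟨(a, b), Finset.mem_filter.2 ⟨Finset.mem_univ _, hab⟩, rfl⟩⟩
  refine ⟨D.min' hDne, ?_, ?_⟩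
  · obtain ⟨p, hp, hpe⟩ := Finset.mem_image.1 (D.min'_mem hDne)
    rw [Finset.mem_filter] at hp
    intro h0
    have e := congr_fun (congr_fun h0 p.1) p.2
    simp only [Matrix.of_apply, Matrix.zero_apply, hpe, if_true] at e
    exact hp.2 e
  · intro a b hab
    by_contra hne
    have hmem : (ρ a : ℤ) - ρ b ∈ D := Finset.mem_image.2 ⟨(a, b), Finset.mem_filter.2 ⟨Finset.mem_univ _, hne⟩, rfl⟩
    exact absurd (D.min'_le _ hmem) (not_le.2 hab)

/-- ★ **Unique lifts over the initial subspace (L2.0).**  See the module docstring. [Q1-PROOF §2 CHART; lead Level-2 port map L2.0] -/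
theorem lift_exists_unique (ρ : Fin n → ℕ) (V T W C : Submodule ℂ (Matrix (Fin n) (Fin n) ℂ))
    (hfin : Module.finrank ℂ W = Module.finrank ℂ V)
    (hWinit : ∀ Z ∈ V, ∀ d : ℤ, (∀ a b : Fin n, (ρ a : ℤ) - ρ b < d → Z a b = 0) →
      (Matrix.of fun a b : Fin n => if (ρ a : ℤ) - ρ b = d then Z a b else 0) ∈ W)
    (hVT : V ≤ T) (hWT : W ≤ T) (hCT : C ≤ T)
    (hCgr : ∀ X ∈ C, ∀ d : ℤ, (Matrix.of fun a b : Fin n => if (ρ a : ℤ) - ρ b = d then X a b else 0) ∈ C)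
    (hWC : W ⊓ C = ⊥) (hTWC : T ≤ W ⊔ C) :
    V ⊓ C = ⊥ ∧ T ≤ V ⊔ C ∧
      ∀ b ∈ W, ∀ d : ℤ, (Matrix.of fun a' b' : Fin n => if (ρ a' : ℤ) - ρ b' = d then b a' b' else 0) = b →
        ∃ v ∈ V, v - b ∈ C ∧
          (∀ e : ℤ, e ≤ d → (Matrix.of fun a' b' : Fin n => if (ρ a' : ℤ) - ρ b' = e then (v - b) a' b' else 0) = 0) ∧
          ∀ v' ∈ V, v' - b ∈ C → v' = v := by
  classical
  have hWC' : ∀ x, x ∈ W → x ∈ C → x = 0 := fun x hW hC => by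
    have : x ∈ W ⊓ C := ⟨hW, hC⟩
    rw [hWC] at this; exact (Submodule.mem_bot ℂ).1 this
  -- (1) `V ⊓ C = ⊥`: a lowest component of a member of `V ∩ C` is an initial form lying in `C`
  have hVC : V ⊓ C = ⊥ := by
    rw [eq_bot_iff]
    rintro v ⟨hvV, hvC⟩
    rw [Submodule.mem_bot]
    by_contra hv
    obtain ⟨d₀, hd₀, hlow⟩ := exists_lowest_degree ρ v hv
    exact hd₀ (hWC' _ (hWinit v hvV d₀ hlow) (hCgr v hvC d₀))
  -- (2) `T ≤ V ⊔ C` by dimension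
  haveI : FiniteDimensional ℂ (Matrix (Fin n) (Fin n) ℂ) := inferInstance
  have hVC_le : V ⊔ C ≤ T := sup_le hVT hCT
  have hWCT : W ⊔ C = T := le_antisymm (sup_le hWT hCT) hTWC
  have hdimVC : Module.finrank ℂ (V ⊔ C : Submodule ℂ _) = Module.finrank ℂ T := by
    have h1 := Submodule.finrank_sup_add_finrank_inf_eq V C
    have h2 := Submodule.finrank_sup_add_finrank_inf_eq W C
    rw [hVC, finrank_bot, add_zero] at h1
    rw [hWC, finrank_bot, add_zero, hWCT] at h2
    omega
  have hTVC : T ≤ V ⊔ C := (Submodule.eq_of_le_of_finrank_eq hVC_le hdimVC).symm.le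
  refine ⟨hVC, hTVC, ?_⟩
  -- (3) lifts
  intro b hbW d hbhom
  obtain ⟨v, hvV, c, hcC, hbvc⟩ := Submodule.mem_sup.1 (hTVC (hWT hbW))
  -- `b = v + c`, lift `v`, tail `v - b = -c`
  have htail : v - b = -c := by rw [← hbvc]; abel
  refine ⟨v, hvV, by rw [htail]; exact C.neg_mem hcC, ?_, ?_⟩
  · -- components of `c` of degree `≤ d` vanish
    by_contra hnot
    push Not at hnot
    -- the components of `c` of degree ≤ d that are non-zero: take the lowest one
    set c' : Matrix (Fin n) (Fin n) ℂ := Matrix.of fun a' b' : Fin n => if (ρ a' : ℤ) - ρ b' ≤ d then c a' b' else 0 with hc'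
    have hc'ne : c' ≠ 0 := by
      obtain ⟨e, hed, hne⟩ := hnot
      intro h0
      apply hne
      ext a' b'
      have e0 := congr_fun (congr_fun h0 a') b'
      simp only [hc', Matrix.of_apply, Matrix.zero_apply] at e0
      simp only [Matrix.of_apply, Matrix.zero_apply, htail, Matrix.neg_apply]
      by_cases hdeg : (ρ a' : ℤ) - ρ b' = e
      · rw [if_pos hdeg, if_pos (by omega)] at *
        · rw [e0, neg_zero]
      · rw [if_neg hdeg]
    obtain ⟨e₀, he₀, hlow⟩ := exists_lowest_degree ρ c' hc'ne
    -- `e₀ ≤ d` (components of `c'` above `d` vanish by construction)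
    have he₀d : e₀ ≤ d := by
      by_contra hgt
      apply he₀
      ext a' b'
      simp only [Matrix.of_apply, Matrix.zero_apply, hc']
      split_ifs with h1 h2
      · exfalso; omega
      · rfl
      · rfl
    -- entries of `v` of degree `< e₀` vanish
    have hvlow : ∀ a' b' : Fin n, (ρ a' : ℤ) - ρ b' < e₀ → v a' b' = 0 := by
      intro a' b' hlt
      have hv : v = b - c := by rw [← hbvc]; abel
      have hb0 : b a' b' = 0 := by
        have e1 := congr_fun (congr_fun hbhom a') b'
        simp only [Matrix.of_apply] at e1
        rw [← e1, if_neg (by omega)]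
      have hc0 : c a' b' = 0 := by
        have := hlow a' b' hlt
        simp only [hc', Matrix.of_apply, if_pos (show (ρ a' : ℤ) - ρ b' ≤ d by omega)] at this
        exact this
      rw [hv, Matrix.sub_apply, hb0, hc0, sub_zero]
    have hπv : (Matrix.of fun a' b' : Fin n => if (ρ a' : ℤ) - ρ b' = e₀ then v a' b' else 0) ∈ W := hWinit v hvV e₀ hvlow
    have hπc : (Matrix.of fun a' b' : Fin n => if (ρ a' : ℤ) - ρ b' = e₀ then c a' b' else 0) ∈ C := hCgr c hcC e₀
    -- `π_{e₀} c = π_{e₀} c'` and `π_{e₀} v = π_{e₀} b - π_{e₀} c`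
    have hπcc' : (Matrix.of fun a' b' : Fin n => if (ρ a' : ℤ) - ρ b' = e₀ then c a' b' else 0) =
        Matrix.of fun a' b' : Fin n => if (ρ a' : ℤ) - ρ b' = e₀ then c' a' b' else 0 := by
      ext a' b'; simp only [Matrix.of_apply, hc']
      split_ifs with h1 h2
      · rfl
      · exfalso; omega
      · rfl
    have hπvbc : (Matrix.of fun a' b' : Fin n => if (ρ a' : ℤ) - ρ b' = e₀ then v a' b' else 0) =
        (Matrix.of fun a' b' : Fin n => if (ρ a' : ℤ) - ρ b' = e₀ then b a' b' else 0) -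
          (Matrix.of fun a' b' : Fin n => if (ρ a' : ℤ) - ρ b' = e₀ then c a' b' else 0) := by
      have hv : v = b - c := by rw [← hbvc]; abel
      ext a' b'; simp only [Matrix.of_apply, Matrix.sub_apply, hv]; split_ifs <;> simp
    by_cases he : e₀ = d
    · -- `π_d c = b - π_d v ∈ W ∩ C`
      subst he
      have hπb : (Matrix.of fun a' b' : Fin n => if (ρ a' : ℤ) - ρ b' = e₀ then b a' b' else 0) = b := hbhom
      have hcW : (Matrix.of fun a' b' : Fin n => if (ρ a' : ℤ) - ρ b' = e₀ then c a' b' else 0) ∈ W := by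
        have e1 : (Matrix.of fun a' b' : Fin n => if (ρ a' : ℤ) - ρ b' = e₀ then c a' b' else 0) =
            b - (Matrix.of fun a' b' : Fin n => if (ρ a' : ℤ) - ρ b' = e₀ then v a' b' else 0) := by
          rw [hπvbc, hπb]; abel
        rw [e1]; exact W.sub_mem hbW hπv
      have h0 := hWC' _ hcW hπc
      rw [hπcc'] at h0
      exact he₀ h0
    · -- `e₀ < d`: `π_{e₀} b = 0`, so `π_{e₀} v = -π_{e₀} c ∈ W ∩ C`
      have hπb0 : (Matrix.of fun a' b' : Fin n => if (ρ a' : ℤ) - ρ b' = e₀ then b a' b' else 0) = 0 := by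
        ext a' b'
        simp only [Matrix.of_apply, Matrix.zero_apply]
        split_ifs with h1
        · have e1 := congr_fun (congr_fun hbhom a') b'
          simp only [Matrix.of_apply] at e1
          rw [← e1, if_neg (by omega)]
        · rfl
      have hcW : (Matrix.of fun a' b' : Fin n => if (ρ a' : ℤ) - ρ b' = e₀ then c a' b' else 0) ∈ W := by
        have e1 : (Matrix.of fun a' b' : Fin n => if (ρ a' : ℤ) - ρ b' = e₀ then c a' b' else 0) =
            -(Matrix.of fun a' b' : Fin n => if (ρ a' : ℤ) - ρ b' = e₀ then v a' b' else 0) := by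
          rw [hπvbc, hπb0]; abel
        rw [e1]; exact W.neg_mem hπv
      have h0 := hWC' _ hcW hπc
      rw [hπcc'] at h0
      exact he₀ h0
  · -- uniqueness
    intro v' hv'V hv'C
    have hdiff : v' - v ∈ V ⊓ C := by
      refine ⟨V.sub_mem hv'V hvV, ?_⟩
      have e1 : v' - v = (v' - b) - (v - b) := by abel
      rw [e1]; exact C.sub_mem hv'C (by rw [htail]; exact C.neg_mem hcC)
    rw [hVC, Submodule.mem_bot] at hdiff
    exact (sub_eq_zero.1 hdiff)

end Summit.ValiantsHypothesis.ValiantsHypothesis.Theorems.GrenetZeon.HeavyTopInitialLift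

end
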